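import Summits.AtomisticToContinuum.Crystallization.Theorems.FrustratedLawDichotomyStrainedPatchHomValueT2SoundW

/-!
# (I1) part X — GENERIC SUMMATION BOUNDS for the assembly of `valueLeafT2J_sound` (step 6c): centre/radius reading of interval memberships summed over the
# nine folded coordinates (linear and quadratic terms), the two point-width penalties against the folded half-widths, and the per-label comparison of the
# REAL value-hull / Lipschitz charges of `…SoundR.label_floor` with the INTEGER contributions of `accLabel` (`…SoundT.accLabel_contrib_hull / _lip`)
# (27623 `(H) HomFloor`, hcp half; decomp-a2c hand-1 g49; critic row 1674 (B) (I1) docket).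

No definitions; 0 sorry; standard axioms; no instances / notation / `#eval`.  `--supports stmt-AtomisticToContinuum-27623`.
-/

noncomputable section

namespace Summit.AtomisticToContinuum.Crystallization.Theorems.FrustratedLawDichotomyStrainedPatchHomValueT2Kit

open scoped BigOperators
open Finset
open Literature.Analysis.ValidatedNumerics.Numerics
open Summit.AtomisticToContinuum.Crystallization.Theorems.FrustratedLawDichotomyStrainedPatchHomEntryGram (cen rad abs_sub_cen_le)

/-! ## §1. Linear and quadratic terms read through centre/radius -/

/-- ★ Linear term: memberships `G_k ∈ I_k` ⟹ `Σ (cen/SC)δ − Σ (rad/SC)|δ| ≤ Σ G δ`. [arithmetic] -/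
theorem sum_lin_bound (G δ : ℕ → ℝ) (I : ℕ → FI) (h : ∀ k, k < 9 → FI.mem (G k) (I k)) :
    ∑ k ∈ range 9, ((cen (I k) : ℝ) / SC) * δ k - ∑ k ∈ range 9, ((rad (I k) : ℝ) / SC) * |δ k| ≤ ∑ k ∈ range 9, G k * δ k := by
  rw [← Finset.sum_sub_distrib]
  exact Finset.sum_le_sum fun k hk => lin_ge (abs_sub_cen_le (h k (Finset.mem_range.1 hk)))

/-- ★ Quadratic term: memberships `h_kl ∈ I_kl` ⟹ `ΣΣ (cen/SC)δδ − ΣΣ (rad/SC)|δ||δ| ≤ ΣΣ h δδ`. [arithmetic] -/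
theorem sum_quad_bound (H : ℕ → ℕ → ℝ) (δ : ℕ → ℝ) (I : ℕ → ℕ → FI) (h : ∀ k l, k < 9 → l < 9 → FI.mem (H k l) (I k l)) :
    ∑ k ∈ range 9, ∑ l ∈ range 9, ((cen (I k l) : ℝ) / SC) * (δ k * δ l) -
        ∑ k ∈ range 9, ∑ l ∈ range 9, ((rad (I k l) : ℝ) / SC) * (|δ k| * |δ l|) ≤
      ∑ k ∈ range 9, ∑ l ∈ range 9, H k l * (δ k * δ l) := by
  rw [← Finset.sum_sub_distrib]
  refine Finset.sum_le_sum fun k hk => ?_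
  rw [← Finset.sum_sub_distrib]
  exact Finset.sum_le_sum fun l hl => mul_ge_of_abs_sub_le (abs_sub_cen_le (h k l (Finset.mem_range.1 hk) (Finset.mem_range.1 hl)))

/-! ## §2. The two point-width penalties -/

/-- ★ `Σ (r/SC)|δ| ≤ (Σ r·w)/SC²` for `r ≥ 0`, `|δ_k| ≤ w_k/SC`. [arithmetic] -/
theorem pen1_bound (r w : ℕ → ℤ) (δ : ℕ → ℝ) (hr : ∀ k, k < 9 → 0 ≤ r k) (hδ : ∀ k, k < 9 → |δ k| ≤ (w k : ℝ) / SC) :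
    ∑ k ∈ range 9, ((r k : ℝ) / SC) * |δ k| ≤ ((∑ k ∈ range 9, r k * w k : ℤ) : ℝ) / ((SC : ℝ) * SC) := by
  have hS := SC_pos
  push_cast
  rw [Finset.sum_div]
  refine Finset.sum_le_sum fun k hk => ?_
  have hk9 := Finset.mem_range.1 hk
  have h1 : (0 : ℝ) ≤ r k := by exact_mod_cast hr k hk9
  have h2 := hδ k hk9
  rw [div_mul_eq_mul_div, div_le_div_iff₀ hS (mul_pos hS hS)]
  have : (r k : ℝ) * |δ k| * (SC * SC) = ((r k : ℝ) * SC) * (|δ k| * SC) := by ring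
  rw [this]
  have h3 : |δ k| * SC ≤ w k := (le_div_iff₀ hS).1 h2
  nlinarith [mul_nonneg h1 hS.le]

/-- ★ `ΣΣ (r/SC)|δ||δ| ≤ (ΣΣ r·w·w)/SC³` for `r ≥ 0`, `|δ_k| ≤ w_k/SC`. [arithmetic] -/
theorem pen2_bound (r : ℕ → ℕ → ℤ) (w : ℕ → ℤ) (δ : ℕ → ℝ) (hr : ∀ k l, k < 9 → l < 9 → 0 ≤ r k l)
    (hδ : ∀ k, k < 9 → |δ k| ≤ (w k : ℝ) / SC) :
    ∑ k ∈ range 9, ∑ l ∈ range 9, ((r k l : ℝ) / SC) * (|δ k| * |δ l|) ≤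
      ((∑ k ∈ range 9, ∑ l ∈ range 9, r k l * w k * w l : ℤ) : ℝ) / ((SC : ℝ) * SC * SC) := by
  have hS := SC_pos
  push_cast
  rw [Finset.sum_div]
  refine Finset.sum_le_sum fun k hk => ?_
  rw [Finset.sum_div]
  refine Finset.sum_le_sum fun l hl => ?_
  have hk9 := Finset.mem_range.1 hk
  have hl9 := Finset.mem_range.1 hl
  have h1 : (0 : ℝ) ≤ r k l := by exact_mod_cast hr k l hk9 hl9
  have hk' : |δ k| * SC ≤ w k := (le_div_iff₀ hS).1 (hδ k hk9)
  have hl' : |δ l| * SC ≤ w l := (le_div_iff₀ hS).1 (hδ l hl9)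
  rw [div_mul_eq_mul_div, div_le_div_iff₀ hS (by positivity)]
  have e : (r k l : ℝ) * (|δ k| * |δ l|) * (SC * SC * SC) = (r k l : ℝ) * SC * ((|δ k| * SC) * (|δ l| * SC)) := by ring
  rw [e]
  have h4 : (|δ k| * SC) * (|δ l| * SC) ≤ (w k : ℝ) * w l :=
    mul_le_mul hk' hl' (mul_nonneg (abs_nonneg _) hS.le) ((mul_nonneg (abs_nonneg _) hS.le).trans hk')
  nlinarith [mul_nonneg h1 hS.le]

/-! ## §3. Per-label charges: real (from `label_floor`) versus integer (from `accLabel`) -/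

/-- ★ Value-hull charge: `Σ_{k,l<top} (M_kl/SC)|δ_k||δ_l| ≤ (Σ_{a,b<9} [blk]·M·w_a·w_b)/SC³` when `blk` holds below `top ≤ 9`, `M ≥ 0`, `|δ| ≤ w/SC`, `w ≥ 0`.
[arithmetic] -/
theorem hull_charge_le {top : ℕ} (htop : top ≤ 9) (M : ℕ → ℕ → ℤ) (blk : ℕ → ℕ → Bool) (w : ℕ → ℤ) (δ : ℕ → ℝ)
    (hM : ∀ a b, 0 ≤ M a b) (hw : ∀ k, 0 ≤ w k) (hblk : ∀ a b, a < top → b < top → blk a b = true)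
    (hδ : ∀ k, k < 9 → |δ k| ≤ (w k : ℝ) / SC) :
    ∑ k ∈ range top, ∑ l ∈ range top, ((M k l : ℝ) / SC) * (|δ k| * |δ l|) ≤
      ((∑ a ∈ range 9, ∑ b ∈ range 9, (if blk a b then M a b * w a * w b else 0) : ℤ) : ℝ) / ((SC : ℝ) * SC * SC) := by
  have hS := SC_pos
  -- compare with the full `9 × 9` sum of the nonnegative majorants
  have step1 : ∑ k ∈ range top, ∑ l ∈ range top, ((M k l : ℝ) / SC) * (|δ k| * |δ l|) ≤
      ∑ k ∈ range top, ∑ l ∈ range top, (M k l : ℝ) * w k * w l / ((SC : ℝ) * SC * SC) := by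
    refine Finset.sum_le_sum fun k hk => Finset.sum_le_sum fun l hl => ?_
    have hk9 : k < 9 := (Finset.mem_range.1 hk).trans_le htop
    have hl9 : l < 9 := (Finset.mem_range.1 hl).trans_le htop
    have h1 : (0 : ℝ) ≤ M k l := by exact_mod_cast hM k l
    have hk' : |δ k| * SC ≤ w k := (le_div_iff₀ hS).1 (hδ k hk9)
    have hl' : |δ l| * SC ≤ w l := (le_div_iff₀ hS).1 (hδ l hl9)
    rw [div_mul_eq_mul_div, div_le_div_iff₀ hS (by positivity)]
    have e : (M k l : ℝ) * (|δ k| * |δ l|) * (SC * SC * SC) = (M k l : ℝ) * SC * ((|δ k| * SC) * (|δ l| * SC)) := by ring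
    rw [e]
    have h4 : (|δ k| * SC) * (|δ l| * SC) ≤ (w k : ℝ) * w l :=
      mul_le_mul hk' hl' (mul_nonneg (abs_nonneg _) hS.le) ((mul_nonneg (abs_nonneg _) hS.le).trans hk')
    nlinarith [mul_nonneg h1 hS.le]
  refine step1.trans ?_
  push_cast
  simp only [← Finset.sum_div]
  refine div_le_div_of_nonneg_right ?_ (by positivity)
  -- the `top`-sums are sub-sums of the indicator `9`-sums of nonnegative terms
  have hsub : range top ⊆ range 9 := Finset.range_subset_range.2 htop
  have hnn : ∀ a b, (0 : ℝ) ≤ (if blk a b then ((M a b : ℝ)) * w a * w b else 0) := fun a b => by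
    split_ifs
    · have := hM a b; have := hw a; have := hw b; positivity
    · exact le_rfl
  calc ∑ k ∈ range top, ∑ l ∈ range top, (M k l : ℝ) * w k * w l
      = ∑ k ∈ range top, ∑ l ∈ range top, (if blk k l then (M k l : ℝ) * w k * w l else 0) :=
        Finset.sum_congr rfl fun k hk => Finset.sum_congr rfl fun l hl => by
          rw [if_pos (hblk k l (Finset.mem_range.1 hk) (Finset.mem_range.1 hl))]
    _ ≤ ∑ k ∈ range 9, ∑ l ∈ range top, (if blk k l then (M k l : ℝ) * w k * w l else 0) :=
        Finset.sum_le_sum_of_subset_of_nonneg hsub fun k _ _ => Finset.sum_nonneg fun l _ => hnn k l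
    _ ≤ ∑ k ∈ range 9, ∑ l ∈ range 9, (if blk k l then (M k l : ℝ) * w k * w l else 0) :=
        Finset.sum_le_sum fun k _ => Finset.sum_le_sum_of_subset_of_nonneg hsub fun l _ _ => hnn k l
    _ = ∑ a ∈ range 9, ∑ b ∈ range 9, (if blk a b then ((M a b : ℝ)) * (w a : ℝ) * (w b : ℝ) else 0) := rfl
    _ = _ := by
        refine Finset.sum_congr rfl fun a _ => Finset.sum_congr rfl fun b _ => ?_
        split_ifs <;> simp

/-- ★ Lipschitz charge: `Σ_{a≤b≤m<top} μ·(absHi/SC)·|δδδ| ≤ (Σ_{a≤b≤m<top} wSym·absHi·w_a w_b w_m / SC)/SC³` (`μ = wSym wJ`, `|δ| ≤ w/SC`, `w ≥ 0`). [arithmetic] -/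
theorem lip_charge_le {top : ℕ} (htop : top ≤ 9) (R : DRec) (w : ℕ → ℤ) (δ : ℕ → ℝ) (hw : ∀ k, 0 ≤ w k)
    (hδ : ∀ k, k < 9 → |δ k| ≤ (w k : ℝ) / SC) :
    ∑ a ∈ range top, ∑ b ∈ range top, ∑ m ∈ range top,
        (if a ≤ b ∧ b ≤ m then (if a = b then (if b = m then (1 : ℝ) else 3) else (if b = m then 3 else 6)) *
          ((((thirdOf R a b m).absHi : ℤ) : ℝ) / SC * (|δ a| * |δ b| * |δ m|)) else 0) ≤
      (∑ a ∈ range top, ∑ b ∈ range top, ∑ m ∈ range top,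
        (if a ≤ b ∧ b ≤ m then ((wSym wJ a b m : ℤ) : ℝ) * ((thirdOf R a b m).absHi : ℝ) * (w a : ℝ) * (w b : ℝ) * (w m : ℝ) / SC else 0)) /
        ((SC : ℝ) * SC * SC) := by
  have hS := SC_pos
  have hS3 : (0 : ℝ) < (SC : ℝ) * SC * SC := by positivity
  rw [Finset.sum_div]
  refine Finset.sum_le_sum fun a ha => ?_
  rw [Finset.sum_div]
  refine Finset.sum_le_sum fun b hb => ?_
  rw [Finset.sum_div]
  refine Finset.sum_le_sum fun m hm => ?_
  have ha9 : a < 9 := (Finset.mem_range.1 ha).trans_le htop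
  have hb9 : b < 9 := (Finset.mem_range.1 hb).trans_le htop
  have hm9 : m < 9 := (Finset.mem_range.1 hm).trans_le htop
  by_cases hs : a ≤ b ∧ b ≤ m
  · rw [if_pos hs, if_pos hs]
    have hmult : (if a = b then (if b = m then (1 : ℝ) else 3) else (if b = m then 3 else 6)) = ((wSym wJ a b m : ℤ) : ℝ) := by
      rw [wSym_wJ_eq ha9 hb9 hm9 hs.1 hs.2]; push_cast; split_ifs <;> norm_num
    rw [hmult]
    have hW : (0 : ℝ) ≤ ((wSym wJ a b m : ℤ) : ℝ) := by rw [← hmult]; split_ifs <;> norm_num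
    have hA : (0 : ℝ) ≤ ((thirdOf R a b m).absHi : ℝ) := by exact_mod_cast absHi_nonneg _
    have hwa : (0 : ℝ) ≤ w a := by exact_mod_cast hw a
    have hwb : (0 : ℝ) ≤ w b := by exact_mod_cast hw b
    have hwm : (0 : ℝ) ≤ w m := by exact_mod_cast hw m
    have hda := hδ a ha9; have hdb := hδ b hb9; have hdm := hδ m hm9
    have hD : |δ a| * |δ b| * |δ m| ≤ (w a : ℝ) / SC * ((w b : ℝ) / SC) * ((w m : ℝ) / SC) :=
      mul_le_mul (mul_le_mul hda hdb (abs_nonneg _) ((abs_nonneg _).trans hda)) hdm (abs_nonneg _)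
        ((mul_nonneg (abs_nonneg _) (abs_nonneg _)).trans (mul_le_mul hda hdb (abs_nonneg _) ((abs_nonneg _).trans hda)))
    have hcoef : (0 : ℝ) ≤ ((wSym wJ a b m : ℤ) : ℝ) * (((thirdOf R a b m).absHi : ℤ) : ℝ) / SC := by positivity
    calc ((wSym wJ a b m : ℤ) : ℝ) * ((((thirdOf R a b m).absHi : ℤ) : ℝ) / SC * (|δ a| * |δ b| * |δ m|))
        = (((wSym wJ a b m : ℤ) : ℝ) * (((thirdOf R a b m).absHi : ℤ) : ℝ) / SC) * (|δ a| * |δ b| * |δ m|) := by ring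
      _ ≤ (((wSym wJ a b m : ℤ) : ℝ) * (((thirdOf R a b m).absHi : ℤ) : ℝ) / SC) * ((w a : ℝ) / SC * ((w b : ℝ) / SC) * ((w m : ℝ) / SC)) :=
        mul_le_mul_of_nonneg_left hD hcoef
      _ = ((wSym wJ a b m : ℤ) : ℝ) * ((thirdOf R a b m).absHi : ℝ) * (w a : ℝ) * (w b : ℝ) * (w m : ℝ) / SC / ((SC : ℝ) * SC * SC) := by
        field_simp
  · rw [if_neg hs, if_neg hs, zero_div]

end Summit.AtomisticToContinuum.Crystallization.Theorems.FrustratedLawDichotomyStrainedPatchHomValueT2Kit
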